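import Summits.Ventures.WeilGRH.OnePrimeTransfer
import Literature.Analysis.FluidPDE.Wei2016HardyLemma
import HarnessLib

/-!
# GRH arm (rh-explicit, venture WeilGRH): elementary pieces for the reflection inequality

Bookkeeping used by `ReflectionInequality.lean` / `ReflectionTransfer.lean`:
* the weighted AM–GM `2uv ≤ μu² + v²/μ` (the optimisation-in-the-weight lemma
  `2e ≤ λW + G/λ ∀λ > 0 ⟹ e² ≤ WG` is the tree's `Wei2016.sq_le_mul_of_forall_two_mul_le`);
* the three elementary integrals `∫ cosh²(x/2)`, `∫ cosh(x/2)cosh((L−x)/2)` (closed forms by FTC);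
* the pointwise identities of the reflected pair `ω z ± w` (parallelogram, polarisation, the folding
  identity `zC + wD = ½[(ωz + w)(conj(ω)C + D) + (ωz − w)(conj(ω)C − D)]` for `|ω| = 1`);
* passing from whole-line integrals of compactly supported functions to interval integrals, and
  `k(L) = ∫ g(x) conj g(x − L) dx` for `k = g ⋆ g̃`.

## References

* H. Yoshida (1992) §6 (the polar bookkeeping `ĝ(1), ĝ(0) = c ± s`); folklore otherwise.
-/

noncomputable section

open Complex Filter Set MeasureTheory
open scoped Real Topology ComplexConjugate ArithmeticFunction.vonMangoldt

namespace Summit.Ventures.WeilGRH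

open Literature.NumberTheory.LFunctions

/-! ## Two inequalities between real numbers -/

/-- Weighted AM–GM: `2uv ≤ μu² + v²/μ` for `μ > 0`. [folklore] -/
theorem two_mul_le_weighted {u v μ : ℝ} (hμ : 0 < μ) : 2 * u * v ≤ μ * u ^ 2 + v ^ 2 / μ := by
  rw [← sub_nonneg]
  have : μ * u ^ 2 + v ^ 2 / μ - 2 * u * v = (μ * u - v) ^ 2 / μ := by
    field_simp
    ring
  rw [this]
  positivity

/- Optimisation in the weight (`2e ≤ λW + G/λ` for all `λ > 0` ⟹ `e² ≤ WG`) is the tree's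
`Literature.Analysis.FluidPDE.Wei2016.sq_le_mul_of_forall_two_mul_le` (imported). -/

/-! ## Three elementary integrals -/

/-- The primitive of `cosh²(x/2)` is `(sinh x + x)/2`. [folklore] -/
theorem hasDerivAt_sinh_add_self_half (x : ℝ) :
    HasDerivAt (fun x ↦ (Real.sinh x + x) / 2) (Real.cosh (x / 2) ^ 2) x := by
  have h1 : HasDerivAt (fun x ↦ (Real.sinh x + x) / 2) ((Real.cosh x + 1) / 2) x :=
    ((Real.hasDerivAt_sinh x).add (hasDerivAt_id x)).div_const 2
  convert h1 using 1
  have h2 := Real.cosh_add (x / 2) (x / 2)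
  rw [add_halves] at h2
  nlinarith [Real.cosh_sq (x / 2)]

/-- `∫_u^v cosh²(x/2) dx = (sinh v + v)/2 − (sinh u + u)/2`. [folklore] -/
theorem integral_cosh_half_sq (u v : ℝ) :
    ∫ x in u..v, Real.cosh (x / 2) ^ 2 = (Real.sinh v + v) / 2 - (Real.sinh u + u) / 2 :=
  intervalIntegral.integral_eq_sub_of_hasDerivAt (fun x _ ↦ hasDerivAt_sinh_add_self_half x)
    ((by fun_prop : Continuous fun x ↦ Real.cosh (x / 2) ^ 2).intervalIntegrable _ _)

/-- `cosh(x/2) cosh((L − x)/2) = (cosh(L/2) + cosh(x − L/2))/2`. [folklore] -/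
theorem cosh_half_mul_cosh_half_sub (L x : ℝ) :
    Real.cosh (x / 2) * Real.cosh ((L - x) / 2) =
      (Real.cosh (L / 2) + Real.cosh (x - L / 2)) / 2 := by
  have h1 := Real.cosh_add (x / 2) ((L - x) / 2)
  have h2 := Real.cosh_sub (x / 2) ((L - x) / 2)
  rw [show x / 2 + (L - x) / 2 = L / 2 by ring] at h1
  rw [show x / 2 - (L - x) / 2 = x - L / 2 by ring] at h2
  linarith

/-- `∫_u^v cosh(x/2)cosh((L−x)/2) dx = [(x cosh(L/2) + sinh(x − L/2))/2]_u^v`. [folklore] -/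
theorem integral_cosh_half_mul_cosh_half_sub (L u v : ℝ) :
    ∫ x in u..v, Real.cosh (x / 2) * Real.cosh ((L - x) / 2) =
      (v * Real.cosh (L / 2) + Real.sinh (v - L / 2)) / 2 -
        (u * Real.cosh (L / 2) + Real.sinh (u - L / 2)) / 2 := by
  have hderiv : ∀ x ∈ uIcc u v, HasDerivAt (fun x ↦ (x * Real.cosh (L / 2) + Real.sinh (x - L / 2)) / 2)
      (Real.cosh (x / 2) * Real.cosh ((L - x) / 2)) x := by
    intro x _
    rw [cosh_half_mul_cosh_half_sub]
    have h1 : HasDerivAt (fun x ↦ x * Real.cosh (L / 2)) (Real.cosh (L / 2)) x := by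
      simpa using (hasDerivAt_id x).mul_const (Real.cosh (L / 2))
    have h2 : HasDerivAt (fun x ↦ Real.sinh (x - L / 2)) (Real.cosh (x - L / 2)) x := by
      simpa using ((hasDerivAt_id x).sub_const (L / 2)).sinh
    exact (h1.add h2).div_const 2
  exact intervalIntegral.integral_eq_sub_of_hasDerivAt hderiv
    ((by fun_prop : Continuous fun x ↦ Real.cosh (x / 2) * Real.cosh ((L - x) / 2)).intervalIntegrable _ _)

/-! ## Pointwise identities for the reflected pair -/

/-- Parallelogram law: `|ωz + w|² + |ωz − w|² = 2(|z|² + |w|²)` for `|ω| = 1`. [folklore] -/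
theorem normSq_reflectPair_add {ω : ℂ} (hω : ‖ω‖ = 1) (z w : ℂ) :
    ‖ω * z + w‖ ^ 2 + ‖ω * z - w‖ ^ 2 = 2 * (‖z‖ ^ 2 + ‖w‖ ^ 2) := by
  simp only [Complex.sq_norm, Complex.normSq_add, Complex.normSq_sub, Complex.normSq_mul]
  rw [← Complex.sq_norm ω, hω]
  ring

/-- Polarisation: `|ωz + w|² − |ωz − w|² = 4 Re(ω z conj w)`. [folklore] -/
theorem normSq_reflectPair_sub (ω z w : ℂ) :
    ‖ω * z + w‖ ^ 2 - ‖ω * z - w‖ ^ 2 = 4 * (ω * (z * conj w)).re := by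
  simp only [Complex.sq_norm, Complex.normSq_add, Complex.normSq_sub, ← mul_assoc]
  ring

/-- `|conj(ω) C ± D|² = C² + D² ± 2 Re(ω) C D` for real `C, D` and `|ω| = 1`. [folklore] -/
theorem normSq_conj_mul_add_real {ω : ℂ} (hω : ‖ω‖ = 1) (C D : ℝ) :
    ‖conj ω * (C : ℂ) + (D : ℂ)‖ ^ 2 = C ^ 2 + D ^ 2 + 2 * ω.re * C * D ∧
      ‖conj ω * (C : ℂ) - (D : ℂ)‖ ^ 2 = C ^ 2 + D ^ 2 - 2 * ω.re * C * D := by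
  have hω2 : ω.re ^ 2 + ω.im ^ 2 = 1 := by
    have h := Complex.sq_norm ω
    rw [hω, Complex.normSq_apply] at h
    nlinarith [h]
  constructor
  · rw [Complex.sq_norm, Complex.normSq_apply]
    simp only [add_re, mul_re, conj_re, conj_im, Complex.ofReal_re, Complex.ofReal_im, mul_zero,
      sub_zero, add_im, mul_im, zero_add, add_zero]
    nlinarith [hω2]
  · rw [Complex.sq_norm, Complex.normSq_apply]
    simp only [sub_re, mul_re, conj_re, conj_im, Complex.ofReal_re, Complex.ofReal_im, mul_zero,
      sub_zero, sub_im, mul_im, zero_add]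
    nlinarith [hω2]

/-- The folding identity: `z C + w D = ½[(ωz + w)(conj(ω) C + D) + (ωz − w)(conj(ω) C − D)]` for
`|ω| = 1`. [folklore] -/
theorem reflectPair_fold {ω : ℂ} (hω : ‖ω‖ = 1) (z w C D : ℂ) :
    z * C + w * D =
      ((ω * z + w) * (conj ω * C + D) + (ω * z - w) * (conj ω * C - D)) / 2 := by
  have h1 : ω * conj ω = 1 := by
    rw [Complex.mul_conj, Complex.normSq_eq_norm_sq, hω]
    norm_num
  have : (ω * z + w) * (conj ω * C + D) + (ω * z - w) * (conj ω * C - D) =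
      2 * ((ω * conj ω) * (z * C) + w * D) := by ring
  rw [this, h1]
  ring

/-! ## From the whole line to windows -/

/-- A whole-line integral of a function vanishing off `[lo, hi]` is the interval integral. [folklore] -/
theorem integral_eq_intervalIntegral_of_zero_off {E : Type*} [NormedAddCommGroup E] [NormedSpace ℝ E]
    {f : ℝ → E} {lo hi : ℝ} (hle : lo ≤ hi) (h : ∀ x, x ∉ Icc lo hi → f x = 0) :
    ∫ x, f x = ∫ x in lo..hi, f x := by
  rw [intervalIntegral.integral_of_le hle, ← integral_Icc_eq_integral_Ioc,
    setIntegral_eq_integral_of_forall_compl_eq_zero h]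

variable {g : ℝ → ℂ}

/-- `k(log 2) = ∫ g(x) conj g(x − log 2) dx` for `k = g ⋆ g̃`. [folklore] -/
theorem weilConv_weilReflect_apply_eq (g : ℝ → ℂ) (L : ℝ) :
    weilConv g (weilReflect g) L = ∫ x, g x * conj (g (x - L)) := by
  rw [weilConv_apply]
  congr 1 with u
  simp [weilReflect, neg_sub]

end Summit.Ventures.WeilGRH
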